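import Summits.ABC.IUTFork.Joshi.ArithTeichmullerSpace
import Literature.AnabelianGeometry.AbsoluteAnabelian.ProfiniteTerminology
import Literature.AnabelianGeometry.AbsoluteAnabelian.SlimTransport
import HarnessLib

/-!
# [J-I] §12 «Appendix: Anabelian Hyperbolic Varieties» and §13 «Anabelian variations providing Π» — typed, NOT asserted

Block E of the abc-iut cell (rung LADDER-ABC:A2.E), seat abc-iut-E-t12, slot T-51 of plan/E/ASSIGNMENTS.md v2 ([J-I] fan-out,
E-plan-2 07:04:11Z, rules r1–r5); inventory plan/E/t12/INVENTORY-T51.tsv; node ids (arXiv **v4** numbering, JOSHI-DAG §7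
concordance) J1:Rmk12.3.1, J1:Prop12.5.1, J1:Def12.5.2, J1:Rmk12.5.3, J1:Prop12.5.4, J1:Conj12.6.1, J1:Rmk12.6.2 (+ un-numbered
§12.1, §12.2, §12.4, §13.6). SOURCE: K. Joshi, *Construction of Arithmetic Teichmuller Spaces I*, arXiv:2106.11452**v4** (unrefereed;
bib `Joshi2021ATS1`), §12 = PDF pp. 55–56, §13 = pp. 57–58 of the cell's PDF-paged render
`HOME/plan/repair/lit/renders/Joshi-ATS1-2106.11452v4-PDFpaged-book-anonnd/pNNNN.txt` (locators «p.N l.a–b»).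

FRAMING (binding): typed ≠ proved; typed AS A CANDIDATE ≠ endorsed; NO side taken on [IUTchIII] Cor. 3.12, on Joshi's claims or on
Mochizuki's 2024 report on them; nothing here bears on abc (§12–§13 are appendices: class P4, no object on the S-spine). Statements
Joshi ASSERTS are `@[claim "Joshi2021ATS1" "disputed"] def … : Prop` ("disputed" = the registered status word E-t1's [J-I] file
uses; it records that a dispute exists in print and takes no side); Conjecture 12.6.1 is a conjecture SHELL (a `Prop` STATED by the
source, never asserted, never a fact — the pattern of `ATS4Statements.AbcConjecture`).

RULES r1/r3 (E-t1 = carrier owner of [J-I]): §13.2–§13.5, §13.8–§13.9 and Thm. 13.13.1 ARE E-t1's `Joshi.AnabelianVariation`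
(`.IsTrivial`, `.IsGeometric`, `.not_isTrivial_of_isGeometric` — §13.9 PROVED there) and `Joshi.ATSObj.variation` (p428170): imported BY
NAME, nothing re-declared; this file adds only §13.6 (the labeling function) over E-t1's structure. §12.4 "slim" is the tree's
`Literature.AlgebraicGeometry.Frobenioids.IsSlimGroup` (centraliser form) and Joshi's sentence "slim iff every open subgroup has
trivial centre [Mochizuki 2004, Def. 0.1, Rmk. 0.1.3]" IS the tree's theorem
`Literature.AnabelianGeometry.AbsoluteAnabelian.isSlimGroup_iff_forall_isOpen_center_eq_bot` — cited, not restated.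

INTERIM CARRIER (ASSIGNMENTS §0.3; merge-debt → E-t1 `TemperedCurve`/`ATSObj` for the one-dimensional case): §12 speaks of
smooth quasi-projective varieties of arbitrary dimension over finitely generated or `p`-adic fields, their Zariski opens, étale and
tempered fundamental groups and Brody hyperbolicity of the Berkovich analytification — none of which the tree or Mathlib has; they
are the fields of the abstract signature `HyperbolicVarietyDatum` below, each with its locator, and NOTHING of §12 is asserted.

FAITHFULNESS FLAGS (for E-ref; recorded, not adjudicated): (F-T51-a) Def. 12.5.2 asks slimness of the geometric TEMPERED group while
Prop. 12.5.4's citation [Mochizuki 2004 = AbsAnab, Lem. 1.3.1 / Cor. 1.3.3] is about PROFINITE groups (our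
`Literature.AnabelianGeometry.AbsoluteAnabelian.GeomAndArithSlim`); tempered slimness ([André 2003], [SemiAnbd]) is not cited;
(F-T51-b) Rmk. 12.6.2 (2) "for `dim(X) = 1`, Conjecture 12.6.1 is a well-known theorem of [Mochizuki, 1996], [Tamagawa, 1997]" — for a
`p`-adic base field the ABSOLUTE isomorphism form for arbitrary hyperbolic curves is not those theorems (relative Grothendieck
conjecture over sub-`p`-adic / finitely generated fields; absolute `p`-adic results need Belyi-type hypotheses, [AbsTopIII]); typed
verbatim as the claim `Rmk1262Dim1`.
-/

noncomputable section

namespace Summit.ABC.IUTFork.Joshi.ATS1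

open Literature.AlgebraicGeometry.Frobenioids (IsSlimGroup)
open Literature.AnabelianGeometry.AbsoluteAnabelian

universe u

/-! ## 1. The signature of §12 (J1:§12.1) -/

/-- **The signature §12 reads** ([J-I] v4 §12.1–§12.6, p.55 l.6 – p.56 l.33): a universe `Var` of "geometrically connected,
smooth [quasi-]projective variet[ies]" `X/E` over base fields that are "finitely generated field[s] of characteristic zero or
`p`-adic field[s]" (p.55 l.32–33), each with its dimension, the relation "`U` is a nonempty Zariski open of `X`" and the bases of
such opens, the predicate "`X/E` is a hyperbolic variety [i.e.] the analytic space `X^{an}/Ê` is a (Brody) hyperbolic variety" (§12.1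
p.55 l.9–12, [Lang 1986], [Javanpeykar–Vezzani 2018]), "`X ×_E ℂ` is a hyperbolic Riemann surface" (§12.2), the étale fundamental
group `π₁(X/E)` and "the geometric tempered étale fundamental group `π₁(X/Ē)`" (Def. 12.5.2 p.56 l.12–13) as topological groups, the
sets `Isom_E(U,V)` and `Isom^{out}_{G_E}(π₁(U/E), π₁(V/E))` with the functoriality map between them (Prop. 12.5.1 (2)), and
"isomorphism `Y ≃ X` of `ℤ`-schemes" (Conj. 12.6.1). DATA ONLY — no property is asserted. Interim carrier (merge-debt → E-t1's
`TemperedCurve` / `ATSObj` in dimension one). [claim: Joshi2021ATS1, status: disputed] -/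
structure HyperbolicVarietyDatum : Type (u + 1) where
  /-- varieties `X/E` (with their base field, finitely generated of char. 0 or `p`-adic) — type of -/
  Var : Type u
  /-- `dim(X)` -/
  dim : Var → ℕ
  /-- "`U` is a nonempty Zariski open subset of `X`" (regarded as a variety over the same field) -/
  IsOpenOf : Var → Var → Prop
  /-- "`{U}` is a basis of Zariski open subsets of `X`" (Prop. 12.5.1, p.55 l.33–34) -/
  IsBasisOf : Var → Set Var → Prop
  /-- members of a basis of opens of `X` are nonempty opens of `X` -/
  isOpenOf_of_mem : ∀ X (𝒰 : Set Var), IsBasisOf X 𝒰 → ∀ U ∈ 𝒰, IsOpenOf U X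
  /-- §12.1: "`X/E` is a hyperbolic variety if the analytic space `X^{an}/Ê` is a (Brody) hyperbolic variety" -/
  IsHyperbolic : Var → Prop
  /-- §12.2: "`X ×_E ℂ` is a hyperbolic Riemann surface" (for curves) -/
  IsHyperbolicRiemannSurface : Var → Prop
  /-- the étale fundamental group `π₁(X/E)` (profinite; a topological group) -/
  pi1 : Var → Type u
  [group_pi1 : ∀ X, Group (pi1 X)]
  [top_pi1 : ∀ X, TopologicalSpace (pi1 X)]
  [topGroup_pi1 : ∀ X, IsTopologicalGroup (pi1 X)]
  /-- "the geometric tempered étale fundamental group `π₁(X/Ē)`" (Def. 12.5.2) -/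
  pi1GeomTemp : Var → Type u
  [group_pi1GeomTemp : ∀ X, Group (pi1GeomTemp X)]
  [top_pi1GeomTemp : ∀ X, TopologicalSpace (pi1GeomTemp X)]
  [topGroup_pi1GeomTemp : ∀ X, IsTopologicalGroup (pi1GeomTemp X)]
  /-- `Isom_E(U, V)`: isomorphisms of varieties over `E` (Prop. 12.5.1 (2)) -/
  IsomE : Var → Var → Type u
  /-- `Isom^{out}_{G_E}(π₁(U/E), π₁(V/E))`: outer isomorphisms over `G_E` (Prop. 12.5.1 (2)) -/
  IsomOut : Var → Var → Type u
  /-- the functoriality map `Isom_E(U,V) → Isom^{out}_{G_E}(π₁(U/E), π₁(V/E))` -/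
  isomMap : ∀ U V, IsomE U V → IsomOut U V
  /-- "isomorphism `Y ≃ X` of `ℤ`-schemes" (Conj. 12.6.1, p.56 l.32–33) -/
  IsoZ : Var → Var → Prop

attribute [instance] HyperbolicVarietyDatum.group_pi1 HyperbolicVarietyDatum.top_pi1 HyperbolicVarietyDatum.topGroup_pi1
  HyperbolicVarietyDatum.group_pi1GeomTemp HyperbolicVarietyDatum.top_pi1GeomTemp HyperbolicVarietyDatum.topGroup_pi1GeomTemp

namespace HyperbolicVarietyDatum

variable (D : HyperbolicVarietyDatum.{u})

/-! ## 2. §12.2–§12.4 -/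

/-- **[J-I] §12.2** (p.55 l.13–14, verbatim): "If `dim(X) = 1` then `X/E` is hyperbolic (in the above sense) if and only if `X ×_E ℂ` is
a hyperbolic Riemann surface." NOT asserted. -/
@[claim "Joshi2021ATS1" "disputed"]
def HyperbolicCurveIff : Prop := ∀ X : D.Var, D.dim X = 1 → (D.IsHyperbolic X ↔ D.IsHyperbolicRiemannSurface X)

/- **[J-I] §12.4** (p.55 l.27–30, verbatim): "a profinite group `Π` is said to be a slim profinite group (or simply `Π` is slim) if
every open subgroup of `Π` has trivial center. By [Mochizuki, 2004, Def. 0.1 and Remark 0.1.3], `Π` is slim if and only if the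
centralizer of any open subgroup of `Π` is trivial." = the tree's `IsSlimGroup` (centraliser form, [FrdI] §0) together with the tree's
theorem `Literature.AnabelianGeometry.AbsoluteAnabelian.isSlimGroup_iff_forall_isOpen_center_eq_bot` ([AbsAnab] Rmk. 0.1.3) — CITED BY
NAME, not restated (registry row J1:§12.4 = DERIVED by import). -/

/-! ## 3. §12.5: Proposition 12.5.1, Definition 12.5.2, Remark 12.5.3, Proposition 12.5.4 -/

/-- **[J-I] Proposition 12.5.1** (p.55 l.31 – p.56 l.1, verbatim): "Let `X/E` be a geometrically connected, smooth, hyperbolic variety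
over a finitely generated field `E` of characteristic zero or a `p`-adic field. Then there exists a basis of Zariski open subsets
`{U}` of `X` such that (1) every `U ≠ ∅` in this basis is hyperbolic, and (2) for every pair `U, V` nonempty opens in this basis one
has `Isom_E(U, V) ≃ Isom^{out}_{G_E}(π₁(U/E), π₁(V/E))`, (3) and for every `U ≠ ∅`, `π₁(U/E)` is slim." (Proof cites [Schmidt–Stix 2016,
Cor. 1.7], [Hoshi 2014, Thm. C], [Lang 1986]; (2) is typed as bijectivity of the functoriality map.) NOT asserted. -/
@[claim "Joshi2021ATS1" "disputed"]
def Prop1251 : Prop :=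
  ∀ X : D.Var, D.IsHyperbolic X → ∃ 𝒰 : Set D.Var, D.IsBasisOf X 𝒰 ∧
    (∀ U ∈ 𝒰, D.IsHyperbolic U) ∧
    (∀ U ∈ 𝒰, ∀ V ∈ 𝒰, Function.Bijective (D.isomMap U V)) ∧
    (∀ U ∈ 𝒰, IsSlimGroup (D.pi1 U))

/-- **[J-I] Definition 12.5.2** (p.56 l.10–13, verbatim): "Let `X/E` be an hyperbolic variety over a `p`-adic field or a finitely
generated field `E`. … Then `X` is said to be an anabelian hyperbolic variety if the étale fundamental group `π₁(X/E)` and the geometric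
tempered étale fundamental group `π₁(X/Ē)` are both slim." (Slim = `IsSlimGroup`, §12.4.) OUR nearest: [AbsAnab] Lem. 1.3.1 predicate
`Literature.AnabelianGeometry.AbsoluteAnabelian.GeomAndArithSlim` (PROFINITE `Δ`, `Π`; FLAG F-T51-a: Joshi's geometric group is the
TEMPERED one). [claim: Joshi2021ATS1, status: disputed] -/
def IsAnabelianHyperbolic (X : D.Var) : Prop :=
  D.IsHyperbolic X ∧ IsSlimGroup (D.pi1 X) ∧ IsSlimGroup (D.pi1GeomTemp X)

/-- An anabelian hyperbolic variety is hyperbolic (bookkeeping). [folklore] -/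
theorem isHyperbolic_of_isAnabelianHyperbolic {X : D.Var} (h : D.IsAnabelianHyperbolic X) : D.IsHyperbolic X := h.1

/-- … and its étale fundamental group is slim, i.e. (§12.4) every open subgroup has trivial centre. [folklore] -/
theorem center_eq_bot_of_isAnabelianHyperbolic {X : D.Var} (h : D.IsAnabelianHyperbolic X) (U : Subgroup (D.pi1 X))
    (hU : IsOpen (U : Set (D.pi1 X))) : Subgroup.center U = ⊥ :=
  (isSlimGroup_iff_forall_isOpen_center_eq_bot (G := D.pi1 X)).1 h.2.1 U hU

/-- **[J-I] Remark 12.5.3** (p.56 l.14–23): "There exist hyperbolic varieties which are not anabelian hyperbolic [i.e.] non-slim (see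
[Ihara and Nakamura, 1997])"; the addendum ("which will not be used in the rest of this paper"): for `D ⊂ A` an irreducible smooth
ample divisor on a simple abelian variety over a number field, `π₁(D × Ē) ≃ π₁(A × Ē)` [Debarre 1995, Thm. 4.1] is not slim, `D` is
hyperbolic [Lang 1986], so `D` is not anabelian hyperbolic (and has finitely many rational points [Faltings 1991, Thm. 1]). Typed as
the existence claim over the signature. NOT asserted. -/
@[claim "Joshi2021ATS1" "disputed"]
def ExistsNonAnabelianHyperbolic : Prop := ∃ X : D.Var, D.IsHyperbolic X ∧ ¬ D.IsAnabelianHyperbolic X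

/-- **[J-I] Proposition 12.5.4** (p.56 l.24–27, verbatim): "If `X/E` is a hyperbolic curve over a `p`-adic field or a finitely
generated field `E` then `X/E` is an anabelian hyperbolic variety. Proof. This is immediate from Definition 12.5.2 and [Mochizuki,
2004, Corollary 1.3.3 and Lemma 1.3.1]." OUR nearest: `Literature.AnabelianGeometry.AbsoluteAnabelian.GeomAndArithSlim` /
`arith_slim_of_geom_slim_of_gal_slim` ([AbsAnab] Lem. 1.3.1, profinite) — FLAG F-T51-a (tempered slimness uncited). NOT asserted. -/
@[claim "Joshi2021ATS1" "disputed"]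
def Prop1254 : Prop := ∀ X : D.Var, D.dim X = 1 → D.IsHyperbolic X → D.IsAnabelianHyperbolic X

/-- Over the signature, Prop. 12.5.4 and Rmk. 12.5.3 together say that a non-anabelian hyperbolic variety has `dim ≠ 1`
(bookkeeping; DERIVED). [folklore] -/
theorem dim_ne_one_of_not_anabelian (h : D.Prop1254) {X : D.Var} (hX : D.IsHyperbolic X) (hn : ¬ D.IsAnabelianHyperbolic X) :
    D.dim X ≠ 1 := fun h1 => hn (h X h1 hX)

/-! ## 4. §12.6: the absolute Grothendieck conjecture (J1:Conj12.6.1, J1:Rmk12.6.2) -/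

/-- "anabelomorphic" ([J-I] §1; Conj. 12.6.1): `X/L` and `Y/L′` have isomorphic étale fundamental groups (as topological groups).
A DEFINITION over the signature. [claim: Joshi2021ATS1, status: disputed] -/
def Anabelomorphic (X Y : D.Var) : Prop := Nonempty (D.pi1 X ≃ₜ* D.pi1 Y)

/-- Anabelomorphy is reflexive. [folklore] -/
theorem anabelomorphic_refl (X : D.Var) : D.Anabelomorphic X X := ⟨ContinuousMulEquiv.refl _⟩

/-- Anabelomorphy is symmetric. [folklore] -/
theorem Anabelomorphic.symm {X Y : D.Var} (h : D.Anabelomorphic X Y) : D.Anabelomorphic Y X := ⟨h.some.symm⟩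

/-- Anabelomorphy is transitive. [folklore] -/
theorem Anabelomorphic.trans {X Y Z : D.Var} (h : D.Anabelomorphic X Y) (h' : D.Anabelomorphic Y Z) : D.Anabelomorphic X Z :=
  ⟨h.some.trans h'.some⟩

/-- Slimness of `π₁` is an invariant of anabelomorphy — by the tree's transport lemma
`Literature.AnabelianGeometry.AbsoluteAnabelian.isSlimGroup_of_continuousMulEquiv` ([AbsTopI] §0). DERIVED (by citation). [folklore] -/
theorem isSlimGroup_pi1_of_anabelomorphic {X Y : D.Var} (h : D.Anabelomorphic X Y) (hX : IsSlimGroup (D.pi1 X)) :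
    IsSlimGroup (D.pi1 Y) :=
  isSlimGroup_of_continuousMulEquiv h.some hX

/-- **[J-I] Conjecture 12.6.1 — the absolute Grothendieck conjecture for anabelian hyperbolic varieties** (p.56 l.28–33, verbatim):
"Let `X/L` be any smooth, quasi-projective and anabelian hyperbolic variety over a finitely generated field or a `p`-adic field `L`.
If `Y/L′` is a smooth, quasi-projective anabelian hyperbolic variety which is anabelomorphic to `X/L` the[n] one has an isomorphism
`Y ≃ X` of `ℤ`-schemes." A conjecture STATED (not asserted) by the source — a `Prop`, never a fact, never a hypothesis of any test.
Rmk. 12.6.2 (1): "This is a formulation, for anabelian hyperbolic varieties, of the celebrated anabelian conjecture of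
Grothendieck." [cite: Joshi2021ATS1, Conj 12.6.1 p.56 l.30–33] -/
def Conj1261 : Prop :=
  ∀ X Y : D.Var, D.IsAnabelianHyperbolic X → D.IsAnabelianHyperbolic Y → D.Anabelomorphic X Y → D.IsoZ Y X

/-- **[J-I] Remark 12.6.2 (2)** (p.56 l.37–39, verbatim): "For `dim(X) = 1`, Conjecture 12.6.1 is a well-known theorem of
[Mochizuki, 1996], [Tamagawa, 1997]." Typed as the claim that the conjecture's conclusion holds between CURVES. FLAG F-T51-b
(STRONGER-THAN-LITERATURE as printed for `p`-adic `L`: the cited theorems are the RELATIVE Grothendieck conjecture over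
sub-`p`-adic / finitely generated fields — OUR nearest `Literature.AnabelianGeometry.AbsoluteAnabelian.RelativeGrothendieckConjecture`
— while absolute `p`-adic statements need Belyi-type hypotheses, [AbsTopIII]); recorded for the referee lane, not adjudicated.
NOT asserted. -/
@[claim "Joshi2021ATS1" "disputed"]
def Rmk1262Dim1 : Prop :=
  ∀ X Y : D.Var, D.dim X = 1 → D.dim Y = 1 →
    D.IsAnabelianHyperbolic X → D.IsAnabelianHyperbolic Y → D.Anabelomorphic X Y → D.IsoZ Y X

/-- The conjecture implies its one-dimensional case (bookkeeping). [folklore] -/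
theorem rmk1262Dim1_of_conj1261 (h : D.Conj1261) : D.Rmk1262Dim1 :=
  fun X Y _ _ hX hY hXY => h X Y hX hY hXY

/-- With Prop. 12.5.4 the one-dimensional case reads: anabelomorphic hyperbolic CURVES are isomorphic as `ℤ`-schemes (the form in
which [J-I] uses it; DERIVED from the two typed claims). [folklore] -/
theorem isoZ_of_curves (h54 : D.Prop1254) (h62 : D.Rmk1262Dim1) {X Y : D.Var} (hX1 : D.dim X = 1) (hY1 : D.dim Y = 1)
    (hX : D.IsHyperbolic X) (hY : D.IsHyperbolic Y) (hXY : D.Anabelomorphic X Y) : D.IsoZ Y X :=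
  h62 X Y hX1 hY1 (h54 X hX1 hX) (h54 Y hY1 hY) hXY

end HyperbolicVarietyDatum

/-! ## 5. §13.6: the labeling function of an anabelian variation (over E-t1's `Joshi.AnabelianVariation`) -/

/-- A **labeled isomorph of `Π`** ([J-I] §13.2 p.57 l.5–12 / §13.6: an object `H ∈ ProD_Π` "isomorphic to `Π`" together with its
labelling isomorphism): a topological group with a fixed isomorphism to `Π`. [claim: Joshi2021ATS1, status: disputed] -/
structure LabeledIsomorph (Pi : Type) [Group Pi] [TopologicalSpace Pi] : Type (u + 1) where
  /-- the isomorph `Π_V` -/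
  carrier : Type u
  [group : Group carrier]
  [top : TopologicalSpace carrier]
  /-- the label `α_V : Π_V ⥲ Π` -/
  label : carrier ≃ₜ* Pi

attribute [instance] LabeledIsomorph.group LabeledIsomorph.top

/-- **[J-I] §13.6** (p.57 l.31–33, verbatim): "Suppose `𝒞` is a non-trivial anabelian variation providing `Π`. Then the function
`V ↦ Π_V` can be thought of as providing labeled isomorphs of `Π` and the function `ob(𝒞) → ProD_Π` (`V ↦ Π_V`) will be called the
labeling function of `𝒞`." Over E-t1's `Joshi.AnabelianVariation` (p428170; §13.3 = its fields `grp`, `label`): the labeling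
function. [claim: Joshi2021ATS1, status: disputed] -/
def labeling {Pi : Type} [Group Pi] [TopologicalSpace Pi] (C : AnabelianVariation.{u} Pi) (V : C.Obj) : LabeledIsomorph.{u} Pi :=
  { carrier := C.grp V, label := C.label V }

/-- The labeling function returns the printed label `α_V` (bookkeeping). [folklore] -/
theorem labeling_label {Pi : Type} [Group Pi] [TopologicalSpace Pi] (C : AnabelianVariation.{u} Pi) (V : C.Obj) :
    (labeling C V).label = C.label V := rfl

/- §13.9 ([J-I] v4 p.58 l.3–5 "Obviously any geometric anabelian variation providing `Π` is non-trivial") IS E-t1's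
`Joshi.AnabelianVariation.not_isTrivial_of_isGeometric` (PROVED there) — cited by name, not re-exported. -/

end Summit.ABC.IUTFork.Joshi.ATS1

end
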